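/- Copyright: the b2b-balaban cell (near-miss cell 7), T⁴-continuum fan-out; row NE7b CRUX team (2), seat
t4-ne7b-formalise-leaf-03 (gen 26) — custodian's part of the OWNER's INTERFACE REQUEST NE7b IR-45-1 ∕ RULING R-OWNER-46-1
(«THE (α) SUPPLIER PLUG OF `priceM`∕`upM` OVER M2 BRICK B → S12-W crew (leaf-03 custodian; E-side leaf-02; leaf-05)»,
HOME/INBOX.md l.8656, `CLAIMS.log` l.31391 ∕ l.31568 ∕ claim l.31515), part 1 of 2.  Released under the licence of the
surrounding project. -/
import Summits.QuantumFields.BalabanUV.T4Continuum.Support.HistoryGenealogyJunctionV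
import Summits.QuantumFields.BalabanUV.T4Continuum.Support.HistoryAssemblyMultKey

/-!
# M2 brick B → the END's witness, part 1: THE MEMBER IDENTIFICATION — the named ∕ key families of a term of a pass-V
input family ARE the images of its dissolved components at the cutoff (re-open object (α) of row NE7b, `SCOPE-alpha.md`
§5 rows M2∕M5; INTERFACE REQUEST NE7b IR-45-1 of the row owner `t4-ne7b-p1` gen 45 «WHAT THE PLUG NEEDS FROM YOUR
JUNCTION KNOWLEDGE … the MEMBER IDENTIFICATION»; lineage `t4-ne7b-formalise-leaf-03` gen 26, custodian of the S12-W crew)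

Summits-side support leaf of the T⁴-continuum cell (rung (B)+1 on a FINITE torus only; NOT infinite volume, NOT the
mass gap, NOT the Clay statement; NOT a proof of the spine estimate NE7b — the cell's OWN estimate, NOT PRINTED, NOT
PROVED).  [folklore] finite combinatorics BY NAME over the owner's pass-V junction (`HistoryGenealogyJunctionV`:
`InputFamily.pedV`∕`liveCV`, `RunInputM.pedMV`∕`histV`) and the lineage's member ∕ key families
(`HistoryAssemblyPedigree.memOf`, `HistoryAssemblyMultKey.kmemOf`∕`keyOf`, leaf-03 g2); no definition, no `[cite:]`
tag, nothing printed asserted, no `Prop` fact minted, zero `sorry`.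

WHAT.  For ANY input family `Φ : InputFamily d ι` in the pass-V currency (`ped := Φ.pedV`, `liveC := Φ.liveCV`) and
any root-cell ∕ physical readings `cellOf : ℕ → ι → ℕ × Lab d → γ`, `phys : ℕ → ι → ℕ × Lab d → δ` (at assembly:
`cellOfR …`, `physV …`): `memOf_pedV` ∕ `kmemOf_pedV` — the named family `{(cellOf K τ (K,x), pedMV.genT (K,x))}` and
the key family `{keyOf … K τ (K,x)}` of `τ` at `K` are the images of `(Φ.run K τ).histV.comp K`; `injOn_named_comp` ∕
`injOn_keyOf_comp` — both maps are injective there under the display `Set.InjOn (cellOf K τ) (liveCV K τ)` (distinct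
root cells; `HistoryRealiseWeakCells.cellOfR_injOn_W` at assembly); **`prod_memOf_pedV_eq`** ∕ **`prod_kmemOf_pedV_eq`**
— `∏_{q ∈ memOf … K τ} F q = ∏_{x ∈ histV.comp K} F (cellOf K τ (K,x), pedMV.genT (K,x))` and its key twin: the bridge
by which leaf-02's key reading (`HistoryPriceKeys`: `FcMOf`, `MULTOf`, node sums on the flat genealogy) meets M2-B's
LIVE ∕ PRICE products over `histV.comp K` (`B16HistoryWeightPlug`, `HistoryBankingCreditPlug`) in part 2
(`HistoryRealiseCellsRunSupplyWTVS`) and its sibling.  With `Φ := ℛ.inputOf` and `τ = ⟨K, a, ι⟩ ∈ termSet I K`,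
`Φ.run K τ = ℛ.runOf K a ι` (`run_inputOf`, `rfl`).

HONEST SCOPE.  Bookkeeping over OUR carriers; proves nothing of Bałaban's; NE7b NOT proved; spine 0∕9.  HONEST
DEPENDENCY (cell): continuum YM on T⁴ ⇐ BetaPertH ∧ nine spine estimates (0/9 proved); BetaPertH ⇐ (D1) ∧ (D4) ∧
CAP+tail; G-an2-4 gates asym, D1 and NE2/3/4.  This file changes none of it.
-/

open Finset
open Literature.MathematicalPhysics.QuantumFieldTheory.Balaban1983to89
open T4PersistenceDictionary
open Summit.QuantumFields.BalabanUV.T4Continuum.HistoryGen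
open Summit.QuantumFields.BalabanUV.T4Continuum.HistoryGenealogyRealise
open Summit.QuantumFields.BalabanUV.T4Continuum.HistoryGenealogyInstantiate
open Summit.QuantumFields.BalabanUV.T4Continuum.HistoryAssemblyPedigree
open Summit.QuantumFields.BalabanUV.T4Continuum.HistoryAssemblyMultKey

namespace Summit.QuantumFields.BalabanUV.T4Continuum.HistoryRealiseCellsRunSupplyMembers

noncomputable section

-- the structural `DecidableEq` instance of the concrete tag type exceeds the default synthesis size (as in the
-- siblings `B16HistoryWeightPlug` ∕ `B16HistoryPricePlug`)
set_option synthInstance.maxSize 1024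

/-! ## §1 The member identification: the named ∕ key families of a term are the images of `histV.comp K` -/

section Members

variable {d : ℕ} {ι γ δ : Type*} [DecidableEq γ] [DecidableEq δ] (Φ : InputFamily d ι)
  (cellOf : ℕ → ι → ℕ × Lab d → γ) (phys : ℕ → ι → ℕ × Lab d → δ)

/-- **THE NAMED FAMILY OF A TERM IN THE PASS-V CURRENCY IS THE IMAGE OF THE DISSOLVED COMPONENTS AT THE CUTOFF**:
`memOf pedV liveCV cellOf K τ = { (cellOf K τ (K,x), pedMV.genT (K,x)) : x ∈ histV.comp K }`. [folklore] -/
theorem memOf_pedV (K : ℕ) (τ : ι) :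
    memOf Φ.pedV Φ.liveCV cellOf K τ =
      ((Φ.run K τ).histV.comp K).image fun x => (cellOf K τ (K, x), (Φ.run K τ).pedMV.genT (K, x)) := by
  rw [memOf, Finset.image_image]
  rfl

/-- **THE KEY FAMILY OF A TERM IN THE PASS-V CURRENCY IS THE IMAGE OF THE DISSOLVED COMPONENTS AT THE CUTOFF**:
`kmemOf pedV liveCV cellOf phys K τ = { keyOf … K τ (K,x) : x ∈ histV.comp K }`. [folklore] -/
theorem kmemOf_pedV (K : ℕ) (τ : ι) :
    kmemOf Φ.pedV Φ.liveCV cellOf phys K τ =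
      ((Φ.run K τ).histV.comp K).image fun x => keyOf Φ.pedV cellOf phys K τ (K, x) := by
  rw [kmemOf, Finset.image_image]
  rfl

variable {Φ cellOf phys}

omit [DecidableEq γ] in
/-- the named member map on `histV.comp K` is injective when the root cells are distinct [folklore] -/
theorem injOn_named_comp {K : ℕ} {τ : ι} (hinj : Set.InjOn (cellOf K τ) (Φ.liveCV K τ : Set (ℕ × Lab d))) :
    Set.InjOn (fun x => (cellOf K τ (K, x), (Φ.run K τ).pedMV.genT (K, x)))
      (((Φ.run K τ).histV.comp K : Finset (Lab d)) : Set (Lab d)) := by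
  intro x hx y hy h
  have h1 : cellOf K τ (K, x) = cellOf K τ (K, y) := congrArg Prod.fst h
  have h2 : (K, x) = (K, y) :=
    hinj (Finset.mem_coe.2 (Finset.mem_image_of_mem _ (Finset.mem_coe.1 hx)))
      (Finset.mem_coe.2 (Finset.mem_image_of_mem _ (Finset.mem_coe.1 hy))) h1
  exact (Prod.mk.inj h2).2

omit [DecidableEq γ] [DecidableEq δ] in
/-- the key map on `histV.comp K` is injective when the root cells are distinct [folklore] -/
theorem injOn_keyOf_comp {K : ℕ} {τ : ι} (hinj : Set.InjOn (cellOf K τ) (Φ.liveCV K τ : Set (ℕ × Lab d))) :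
    Set.InjOn (fun x => keyOf Φ.pedV cellOf phys K τ (K, x))
      (((Φ.run K τ).histV.comp K : Finset (Lab d)) : Set (Lab d)) := by
  intro x hx y hy h
  have h1 : cellOf K τ (K, x) = cellOf K τ (K, y) := congrArg Prod.fst h
  have h2 : (K, x) = (K, y) :=
    hinj (Finset.mem_coe.2 (Finset.mem_image_of_mem _ (Finset.mem_coe.1 hx)))
      (Finset.mem_coe.2 (Finset.mem_image_of_mem _ (Finset.mem_coe.1 hy))) h1
  exact (Prod.mk.inj h2).2

/-- **THE PRODUCT OVER THE NAMED FAMILY IS THE PRODUCT OVER THE DISSOLVED COMPONENTS AT THE CUTOFF** (the identification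
IR-45-1 asks for: `∏_{q ∈ memOf …} F q = ∏_{x ∈ histV.comp K} F (cellOf K τ (K,x), pedMV.genT (K,x))`, without
repetition under distinct root cells). [folklore] -/
theorem prod_memOf_pedV_eq {M : Type*} [CommMonoid M] (F : γ × Gen (Lab (ℕ × Lab d) (Lab d)) → M) {K : ℕ} {τ : ι}
    (hinj : Set.InjOn (cellOf K τ) (Φ.liveCV K τ : Set (ℕ × Lab d))) :
    ∏ q ∈ memOf Φ.pedV Φ.liveCV cellOf K τ, F q =
      ∏ x ∈ (Φ.run K τ).histV.comp K, F (cellOf K τ (K, x), (Φ.run K τ).pedMV.genT (K, x)) := by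
  rw [memOf_pedV, Finset.prod_image (injOn_named_comp hinj)]

/-- **THE PRODUCT OVER THE KEY FAMILY IS THE PRODUCT OVER THE DISSOLVED COMPONENTS AT THE CUTOFF.** [folklore] -/
theorem prod_kmemOf_pedV_eq {M : Type*} [CommMonoid M] (F : γ × Gen PEv × δ → M) {K : ℕ} {τ : ι}
    (hinj : Set.InjOn (cellOf K τ) (Φ.liveCV K τ : Set (ℕ × Lab d))) :
    ∏ w ∈ kmemOf Φ.pedV Φ.liveCV cellOf phys K τ, F w =
      ∏ x ∈ (Φ.run K τ).histV.comp K, F (keyOf Φ.pedV cellOf phys K τ (K, x)) := by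
  rw [kmemOf_pedV, Finset.prod_image (injOn_keyOf_comp hinj)]

end Members

end

end Summit.QuantumFields.BalabanUV.T4Continuum.HistoryRealiseCellsRunSupplyMembers
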